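import Summits.CriticalPhenomena.PercolationContinuityZ3.Theses.PercTiltedBlockers
import Summits.CriticalPhenomena.PercolationContinuityZ3.Theses.PercAnnulusCrossing
import Summits.CriticalPhenomena.PercolationContinuityZ3.Theses.PercDivergentSlabLadder
import Summits.CriticalPhenomena.PercolationContinuityZ3.Theorems.PercTiltedBlockersCubeBlockingSeedLadder
import Summits.CriticalPhenomena.PercolationContinuityZ3.Theorems.PercTiltedBlockersCubeBlockingSeedOfHeightHalving12
import Summits.CriticalPhenomena.PercolationContinuityZ3.Theorems.PercTiltedBlockersCubeBlockingSeedTallSeedOfFlatAnnulusCrossing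
import Summits.CriticalPhenomena.PercolationContinuityZ3.Theorems.PercTiltedBlockersCubeBlockingSeedOfHalvingRung
import HarnessLib

/-!
# Strategist decomposition of crux `CubeBlockingSeed` (stmt-CriticalPhenomena-1141)

`CubeBlockingSeed ⟺ TubeSeed ∧ HalvingRung` (exact cut, `cubeBlockingSeed_iff_tallSeed_and_halvingRung`, p149603).

* `TubeSeed`  — d = 3 positivity at SOME aspect ratio: `∃ k ≥ 1, ∃ c > 0, ∀ n ≥ 1, c ≤ P_{p_c}[(kn; n, n) tube not crossed
  lengthwise inside]`  (threshold aspect ratio k* < ∞).  Known feeder: `FlatAnnulusCrossing` (stmt-6699) ⟹ `TubeSeed`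
  (`stub_tallSeedOfFlatAnnulusCrossing`, p149647).
* `HalvingRung` — aspect-ratio halving at criticality: `∀ k ≥ 1, SeedAt (2k) → SeedAt k` (no intermediate threshold aspect
  ratio k* ∈ [2, ∞)).  Known feeders: `HeightHalving12` ⟹ `HalvingRung` (`halvingRung_of_heightHalving12`, p154610);
  `CritAnnulusNonCrossing` (stmt-0846) ⟹ `HalvingRung` (p154818).

The children texts are VERBATIM the registered stubs `stub_tallSeed` / `stub_halvingRung` of `Lines/birth.lean` (r5).
-/

namespace Summit.CriticalPhenomena.PercolationContinuityZ3.Theses.PercTiltedBlockers.Split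

/-- Sub₁ (crux): the tube seed — some aspect ratio is blocked with uniformly positive probability at `p_c(ℤ³)`. -/
def TubeSeed : Prop :=
  ∃ k : ℕ, 1 ≤ k ∧ ∃ c : ℝ, 0 < c ∧ ∀ n : ℕ, 1 ≤ n → c ≤ (Literature.Probability.Percolation.bondPercolation (Literature.Probability.LatticeModels.zdGraph 3) (Literature.Probability.Percolation.criticalProbI 3)).real {ω | ¬ ∃ x ∈ Finset.Icc (0 : Literature.Probability.LatticeModels.Site 3) ![((k * n : ℕ) : ℤ), n, n], ∃ y ∈ Finset.Icc (0 : Literature.Probability.LatticeModels.Site 3) ![((k * n : ℕ) : ℤ), n, n], x 0 = 0 ∧ y 0 = ((k * n : ℕ) : ℤ) ∧ ω ∈ Literature.Probability.Percolation.openConnIn ↑(Finset.Icc (0 : Literature.Probability.LatticeModels.Site 3) ![((k * n : ℕ) : ℤ), n, n]) x y}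

/-- Sub₂ (crux): the halving rung — `∀ k ≥ 1, SeedAt (2k) → SeedAt k` at `p_c(ℤ³)`. -/
def HalvingRung : Prop :=
  ∀ k : ℕ, 1 ≤ k → (∃ c : ℝ, 0 < c ∧ ∀ n : ℕ, 1 ≤ n → c ≤ (Literature.Probability.Percolation.bondPercolation (Literature.Probability.LatticeModels.zdGraph 3) (Literature.Probability.Percolation.criticalProbI 3)).real {ω | ¬ ∃ x ∈ Finset.Icc (0 : Literature.Probability.LatticeModels.Site 3) ![((2 * k * n : ℕ) : ℤ), n, n], ∃ y ∈ Finset.Icc (0 : Literature.Probability.LatticeModels.Site 3) ![((2 * k * n : ℕ) : ℤ), n, n], x 0 = 0 ∧ y 0 = ((2 * k * n : ℕ) : ℤ) ∧ ω ∈ Literature.Probability.Percolation.openConnIn ↑(Finset.Icc (0 : Literature.Probability.LatticeModels.Site 3) ![((2 * k * n : ℕ) : ℤ), n, n]) x y}) → ∃ c : ℝ, 0 < c ∧ ∀ n : ℕ, 1 ≤ n → c ≤ (Literature.Probability.Percolation.bondPercolation (Literature.Probability.LatticeModels.zdGraph 3) (Literature.Probability.Percolation.criticalProbI 3)).real {ω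 | ¬ ∃ x ∈ Finset.Icc (0 : Literature.Probability.LatticeModels.Site 3) ![((k * n : ℕ) : ℤ), n, n], ∃ y ∈ Finset.Icc (0 : Literature.Probability.LatticeModels.Site 3) ![((k * n : ℕ) : ℤ), n, n], x 0 = 0 ∧ y 0 = ((k * n : ℕ) : ℤ) ∧ ω ∈ Literature.Probability.Percolation.openConnIn ↑(Finset.Icc (0 : Literature.Probability.LatticeModels.Site 3) ![((k * n : ℕ) : ℤ), n, n]) x y}

open Summit.CriticalPhenomena.PercolationContinuityZ3.Theorems in
/-- **The glue** `Sub₁ → Sub₂ → CubeBlockingSeed` (route decl BY NAME), = `cubeBlockingSeed_of_tallSeed_of_halvingRung` (p149603). -/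
theorem CubeBlockingSeed_of_subs :
    TubeSeed → HalvingRung → Summit.CriticalPhenomena.PercolationContinuityZ3.Theses.PercTiltedBlockers.CubeBlockingSeed :=
  fun hT hR => CubeBlockingSeed.cubeBlockingSeed_of_tallSeed_of_halvingRung hT hR

open Summit.CriticalPhenomena.PercolationContinuityZ3.Theorems in
/-- The glue for the item's primary (shared) decl `…Theses.PercAnnulusCrossing.CubeBlockingSeed`. -/
theorem CubeBlockingSeedShared_of_subs :
    TubeSeed → HalvingRung → Summit.CriticalPhenomena.PercolationContinuityZ3.Theses.PercAnnulusCrossing.CubeBlockingSeed :=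
  fun hT hR => CubeBlockingSeed.cubeBlockingSeedShared_of_tallSeed_of_halvingRung hT hR

open Summit.CriticalPhenomena.PercolationContinuityZ3.Theorems in
/-- **Exactness**: the crux gives back both children (so neither child is stronger than the crux). -/
theorem subs_of_CubeBlockingSeed
    (h : Summit.CriticalPhenomena.PercolationContinuityZ3.Theses.PercTiltedBlockers.CubeBlockingSeed) :
    TubeSeed ∧ HalvingRung :=
  ⟨CubeBlockingSeed.tallSeed_of_cubeBlockingSeed h, CubeBlockingSeed.halvingRung_of_cubeBlockingSeed h⟩

theorem CubeBlockingSeed_iff_subs :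
    Summit.CriticalPhenomena.PercolationContinuityZ3.Theses.PercTiltedBlockers.CubeBlockingSeed ↔ TubeSeed ∧ HalvingRung :=
  ⟨subs_of_CubeBlockingSeed, fun h => CubeBlockingSeed_of_subs h.1 h.2⟩

open Summit.CriticalPhenomena.PercolationContinuityZ3.Theorems in
/-- Feeder for Sub₁: `FlatAnnulusCrossing` (stmt-CriticalPhenomena-6699) ⟹ `TubeSeed` (p149647). -/
theorem TubeSeed_of_flatAnnulusCrossing
    (h6699 : Summit.CriticalPhenomena.PercolationContinuityZ3.Theses.PercDivergentSlabLadder.FlatAnnulusCrossing) : TubeSeed :=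
  CubeBlockingSeed.stub_tallSeedOfFlatAnnulusCrossing h6699

open Literature.Probability.Percolation Literature.Probability.LatticeModels
  Summit.CriticalPhenomena.PercolationContinuityZ3.Theorems in
/-- Feeder for Sub₂: bounded-aspect height halving `HeightHalving12` ⟹ `HalvingRung` (p154610). -/
theorem HalvingRung_of_heightHalving12
    (hHH : ∃ g : ℝ → ℝ, Monotone g ∧ (∀ s, 0 < s → 0 < g s) ∧ ∀ h L M : ℕ, 1 ≤ h → 1 ≤ L → 1 ≤ M →
      L ≤ 12 * h → M ≤ 12 * h →
      g ((bondPercolation (zdGraph 3) (criticalProbI 3)).real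
          {ω | ¬ ∃ x ∈ Finset.Icc (0 : Site 3) ![((2 * h : ℕ) : ℤ), L, M],
            ∃ y ∈ Finset.Icc (0 : Site 3) ![((2 * h : ℕ) : ℤ), L, M],
              x 0 = 0 ∧ y 0 = ((2 * h : ℕ) : ℤ) ∧
                ω ∈ openConnIn ↑(Finset.Icc (0 : Site 3) ![((2 * h : ℕ) : ℤ), L, M]) x y}) ≤
        (bondPercolation (zdGraph 3) (criticalProbI 3)).real
          {ω | ¬ ∃ x ∈ Finset.Icc (0 : Site 3) ![(h : ℤ), L, M],
            ∃ y ∈ Finset.Icc (0 : Site 3) ![(h : ℤ), L, M],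
              x 0 = 0 ∧ y 0 = (h : ℤ) ∧
                ω ∈ openConnIn ↑(Finset.Icc (0 : Site 3) ![(h : ℤ), L, M]) x y}) : HalvingRung :=
  CubeBlockingSeed.halvingRung_of_heightHalving12 hHH

open Summit.CriticalPhenomena.PercolationContinuityZ3.Theorems in
/-- Feeder for Sub₂: `CritAnnulusNonCrossing` (stmt-CriticalPhenomena-0846, X_B) ⟹ `HalvingRung` (p154818). -/
theorem HalvingRung_of_critAnnulusNonCrossing
    (h0846 : Summit.CriticalPhenomena.PercolationContinuityZ3.Theses.PercAnnulusCrossing.CritAnnulusNonCrossing) : HalvingRung :=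
  CubeBlockingSeed.halvingRung_of_critAnnulusNonCrossing h0846

end Summit.CriticalPhenomena.PercolationContinuityZ3.Theses.PercTiltedBlockers.Split
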